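import Literature.AnabelianGeometry.EtaleTheta.ThetaSubquotientLevelN

/-!
# [EtTh] §5 / §2: the LEVEL-`N` descent of a topological automorphism of `Π^tp_X` compatible with the theta
# subquotients — the data `(φQ, φΛ)` of the twist of `(l·Δ_Θ ⊗ ℤ/Nℤ)_(−)`, from Cor. 2.18 (i)

Mochizuki, *The étale theta function and its Frobenioid-theoretic manifestations*, Publ. RIMS **45** (2009), §5 p.327 (PDF p.101)
(«the characteristic [cf. Propositions 2.4, 2.6] subquotients `Π^tp_X ↠ (Π^tp_X)^Θ`; `l·Δ_Θ ⊆ (Π^tp_X)^Θ` … preserved by arbitrary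
self-equivalences of `D`»), Cor. 2.18 (i) p.286 (PDF p.60) («the subquotients … `(l·Δ_Θ)`, `(Π^tp_X)^Θ` … of `Π^tp_X` … may be
reconstructed group-theoretically» — tree: `RigidData.Cor218_i`, invariance under every topological automorphism), §2 p.46
(`(l·Δ_Θ) ↠ (l·Δ_Θ) ⊗ ℤ/Nℤ ≅ μ_N`) [cite: MochizukiEtTh2009, §5 p.327 (PDF p.101)].

abc-iut cell, layer L2, seat abc-iut-w5-d013 (gen 4), ROW «T56-L03 step 1b» (proof-only companion of the class (b) construction
`ThetaSubquotientOfTemperedTwist.lean`, p437689).  PROOF-ONLY (no definition, no new named fact): over abc-iut-w4-d042's level-`N`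
parameters `(q_N, ι_N) := (RigidData.qN ιX, RigidData.iotaN)` (`ThetaSubquotientLevelN.lean`), a topological automorphism `γ` of `Π^tp_X`
that stabilises `Ker(Π^tp_X ↠ (Π^tp_X)^Θ)` (`thetaKer`) and `l·Δ_Θ` (`lDeltaTheta`) — the two clauses of `RigidData.Cor218_i` at `γ` —
DESCENDS to level `N`: it stabilises `K_N = Ker(thetaMod)` (`map_levelKer_eq`), hence induces automorphisms `φQ` of `Q_N = Π^tp_X/K_N` and
`φΛ` of `μ_N` with `q_N ∘ (ιX γ ιX⁻¹) = φQ ∘ q_N`, `ι_N ∘ φΛ = φQ ∘ ι_N` and `φΛ (thetaMod g) = thetaMod (γ g)` — exactly the input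
`(φ, φQ, φΛ, hq, hι)` of `ThetaSubquotient.twist` for the level-`N` carrier `RigidData.levelStub`, plus the formula step 2 needs
(`exists_levelTwistData`, `exists_levelTwistData_of_cor218`).  Nothing about the curves of [EtTh] is asserted; Cor. 2.18 (i) enters
BY NAME as a hypothesis where used; no side taken on [IUTchIII] Cor. 3.12.
-/

noncomputable section

namespace Literature.AnabelianGeometry.EtaleTheta

namespace RigidData

universe u v

variable {N : ℕ+} {l : ℕ} (RD : RigidData.{u} N l)

/-! ### `γ` stabilises `K_N` -/

/-- If `γ(Ker(Π^tp_X ↠ (Π^tp_X)^Θ)) ⊆ Ker` and `γ(l·Δ_Θ) ⊆ l·Δ_Θ` then `γ(K_N) ⊆ K_N` (`K_N = thetaKer · (l·Δ_Θ)^N`, `thetaMod_ker`).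
[cite: MochizukiEtTh2009, §2 p.46] -/
theorem map_levelKer_le (γ : RD.PiX →* RD.PiX) (hK : RD.thetaKer.map γ ≤ RD.thetaKer)
    (hL : RD.lDeltaTheta.map γ ≤ RD.lDeltaTheta) : RD.levelKer.map γ ≤ RD.levelKer := by
  rintro _ ⟨k, hk, rfl⟩
  obtain ⟨g, hg, rfl⟩ := (RD.mem_levelKer_iff k).1 hk
  obtain ⟨k₀, hk₀, h, hgh⟩ := (RD.thetaMod_ker g).1 hg
  have hγg : γ (g : RD.PiX) ∈ RD.lDeltaTheta := hL ⟨g, g.2, rfl⟩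
  refine (RD.mem_levelKer_iff _).2 ⟨⟨γ g, hγg⟩, (RD.thetaMod_ker _).2 ⟨γ k₀, hK ⟨k₀, hk₀, rfl⟩, ⟨γ h, hL ⟨h, h.2, rfl⟩⟩, ?_⟩, rfl⟩
  change γ (g : RD.PiX) = γ k₀ * (γ (h : RD.PiX)) ^ (N : ℕ)
  rw [hgh, map_mul, map_pow]

/-- **`γ(K_N) = K_N`** for an automorphism `γ` of `Π^tp_X` stabilising `thetaKer` and `lDeltaTheta` (the Cor. 2.18 (i) clauses).
[cite: MochizukiEtTh2009, §2 p.46; Cor 2.18 (i) p.286 (PDF p.60)] -/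
theorem map_levelKer_eq (γ : RD.PiX ≃* RD.PiX) (hK : RD.thetaKer.map γ.toMonoidHom = RD.thetaKer)
    (hL : RD.lDeltaTheta.map γ.toMonoidHom = RD.lDeltaTheta) : RD.levelKer.map γ.toMonoidHom = RD.levelKer := by
  refine le_antisymm (RD.map_levelKer_le γ.toMonoidHom hK.le hL.le) fun x hx => ?_
  -- the inverse automorphism also stabilises both subgroups
  have hsymm : ∀ S : Subgroup RD.PiX, S.map γ.toMonoidHom = S → S.map γ.symm.toMonoidHom ≤ S := by
    rintro S hS _ ⟨y, hy, rfl⟩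
    rw [← hS] at hy
    obtain ⟨z, hz, rfl⟩ := hy
    change γ.symm (γ z) ∈ S
    rwa [γ.symm_apply_apply]
  exact ⟨γ.symm x, RD.map_levelKer_le γ.symm.toMonoidHom (hsymm _ hK) (hsymm _ hL) ⟨x, hx, rfl⟩, γ.apply_symm_apply x⟩

/-! ### The level-`N` descent data `(φQ, φΛ)` -/

variable {G : Type v} [Group G] [TopologicalSpace G]

/-- **Level-`N` descent of a compatible automorphism.**  For a topological automorphism `γ` of `Π^tp_X` with `γ(thetaKer) = thetaKer`
and `γ(l·Δ_Θ) = l·Δ_Θ` (the clauses of Cor. 2.18 (i) at `γ`) and an identification `ιX : Π^tp_X ≃ Π`, there are automorphisms `φQ` of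
`Q_N = Π^tp_X/K_N` and `φΛ` of `μ_N` such that, with `φ := ιX ∘ γ ∘ ιX⁻¹`: `q_N (φ x) = φQ (q_N x)`, `ι_N (φΛ a) = φQ (ι_N a)`,
`φΛ (thetaMod g) = thetaMod (γ g)` and `φQ [k] = [γ k]` — the input of `ThetaSubquotient.twist` at `(q_N, ι_N)`.
[cite: MochizukiEtTh2009, §5 p.327 (PDF p.101); §2 p.46] -/
theorem exists_levelTwistData (ιX : RD.PiX ≃ₜ* G) (γ : RD.PiX ≃ₜ* RD.PiX)
    (hK : RD.thetaKer.map γ.toMulEquiv.toMonoidHom = RD.thetaKer)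
    (hL : RD.lDeltaTheta.map γ.toMulEquiv.toMonoidHom = RD.lDeltaTheta) :
    ∃ (φQ : RD.LevelQuot ≃* RD.LevelQuot) (φΛ : RD.mu ≃* RD.mu),
      (∀ x : G, RD.qN ιX (((ιX.symm.trans γ).trans ιX) x) = φQ (RD.qN ιX x)) ∧
      (∀ a : RD.mu, RD.iotaN (φΛ a) = φQ (RD.iotaN a)) ∧
      (∀ (g : RD.lDeltaTheta) (hg : γ (g : RD.PiX) ∈ RD.lDeltaTheta), φΛ (RD.thetaMod g) = RD.thetaMod ⟨γ g, hg⟩) ∧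
      (∀ k : RD.PiX, φQ ((k : RD.PiX) : RD.LevelQuot) = ((γ k : RD.PiX) : RD.LevelQuot)) := by
  -- `φQ` on `Π^tp_X / K_N`
  have hmap := RD.map_levelKer_eq γ.toMulEquiv hK hL
  let φQ : RD.LevelQuot ≃* RD.LevelQuot := QuotientGroup.congr RD.levelKer RD.levelKer γ.toMulEquiv hmap
  have hφQ : ∀ k : RD.PiX, φQ ((k : RD.PiX) : RD.LevelQuot) = ((γ k : RD.PiX) : RD.LevelQuot) := fun _ => rfl
  -- `γ` restricted to `l·Δ_Θ`, and its kernel-stability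
  let γL : RD.lDeltaTheta ≃* RD.lDeltaTheta :=
    (γ.toMulEquiv.subgroupMap RD.lDeltaTheta).trans (MulEquiv.subgroupCongr hL)
  have hγL : ∀ g : RD.lDeltaTheta, ((γL g : RD.lDeltaTheta) : RD.PiX) = γ g := fun _ => rfl
  have hker : RD.thetaMod.ker.map γL.toMonoidHom = RD.thetaMod.ker := by
    ext g
    constructor
    · rintro ⟨g₀, hg₀, rfl⟩
      rw [SetLike.mem_coe, MonoidHom.mem_ker, ← coe_mem_levelKer_iff] at hg₀
      rw [MonoidHom.mem_ker, ← coe_mem_levelKer_iff, ← hmap]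
      exact ⟨g₀, hg₀, rfl⟩
    · intro hg
      rw [MonoidHom.mem_ker, ← coe_mem_levelKer_iff, ← hmap] at hg
      obtain ⟨y, hy, hyg⟩ := hg
      refine ⟨⟨y, RD.levelKer_le_lDeltaTheta hy⟩, ?_, Subtype.ext hyg⟩
      rw [SetLike.mem_coe, MonoidHom.mem_ker, ← coe_mem_levelKer_iff]
      exact hy
  -- `φΛ` on `μ_N ≅ (l·Δ_Θ)/Ker(thetaMod)`
  let eμ : RD.lDeltaTheta ⧸ RD.thetaMod.ker ≃* RD.mu := QuotientGroup.quotientKerEquivOfSurjective RD.thetaMod RD.thetaMod_surjective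
  let φΛ : RD.mu ≃* RD.mu := eμ.symm.trans ((QuotientGroup.congr _ _ γL hker).trans eμ)
  have heμ : ∀ g : RD.lDeltaTheta, eμ.symm (RD.thetaMod g) = (g : RD.lDeltaTheta ⧸ RD.thetaMod.ker) := fun g => by
    rw [MulEquiv.symm_apply_eq]
    rfl
  have hφΛ : ∀ (g : RD.lDeltaTheta) (hg : γ (g : RD.PiX) ∈ RD.lDeltaTheta), φΛ (RD.thetaMod g) = RD.thetaMod ⟨γ g, hg⟩ := by
    intro g hg
    change eμ (QuotientGroup.congr _ _ γL hker (eμ.symm (RD.thetaMod g))) = _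
    rw [heμ, QuotientGroup.congr_mk]
    rfl
  refine ⟨φQ, φΛ, fun x => ?_, fun a => ?_, hφΛ, hφQ⟩
  · change RD.qN ιX (ιX (γ (ιX.symm x))) = φQ (QuotientGroup.mk' RD.levelKer (ιX.symm x))
    rw [qN_apply_ιX]
    rfl
  · obtain ⟨g, rfl⟩ := RD.thetaMod_surjective a
    rw [hφΛ g ((hL.le ⟨g, g.2, rfl⟩)), iotaN_thetaMod, iotaN_thetaMod]
    rfl

/-- **The same from Cor. 2.18 (i) BY NAME** (abc-iut-L2-t2's `RigidData.Cor218_i`: every topological automorphism of `Π^tp_X`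
stabilises `thetaKer` and `lDeltaTheta`). [cite: MochizukiEtTh2009, Cor 2.18 (i) p.286 (PDF p.60)] -/
theorem exists_levelTwistData_of_cor218 (h218 : RD.Cor218_i) (ιX : RD.PiX ≃ₜ* G) (γ : RD.PiX ≃ₜ* RD.PiX) :
    ∃ (φQ : RD.LevelQuot ≃* RD.LevelQuot) (φΛ : RD.mu ≃* RD.mu),
      (∀ x : G, RD.qN ιX (((ιX.symm.trans γ).trans ιX) x) = φQ (RD.qN ιX x)) ∧
      (∀ a : RD.mu, RD.iotaN (φΛ a) = φQ (RD.iotaN a)) ∧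
      (∀ (g : RD.lDeltaTheta) (hg : γ (g : RD.PiX) ∈ RD.lDeltaTheta), φΛ (RD.thetaMod g) = RD.thetaMod ⟨γ g, hg⟩) ∧
      (∀ k : RD.PiX, φQ ((k : RD.PiX) : RD.LevelQuot) = ((γ k : RD.PiX) : RD.LevelQuot)) :=
  RD.exists_levelTwistData ιX γ (h218 γ).2.2.2.1 (h218 γ).2.2.2.2.1

end RigidData

end Literature.AnabelianGeometry.EtaleTheta

end
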